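import Summits.QuantumFields.BalabanUV.Beta.GAN24.ContactBorderEntryBoundMf
import Summits.QuantumFields.BalabanUV.Beta.GAN24.BornLambdaContactLineage

/-!
# `BalabanUV.Beta.GAN24.BornBorderContactLineage` — binder row G-an2-4 / (CONV-C), CT-ROUTE, (C4)-V module (C2): **THE WEIGHTED CONTACT ENTRY OF ONE V LINEAGE** at `d = 3`
# — weight `(cE·Lc^8)^{n+1}` against the two border cells ((B2) `ContactBorderEntryBound.abs_contact_border_fm_le`, (B3) `ContactBorderEntryBoundMf.abs_contact_border_mf_le`),
# every letter a HYPOTHESIS with explicit constants; the count is leaf-02 g48's Λ count `BornLambdaContactLineage.units_le ∕ polyS_le` BY NAME: `C·|cVH|·(n+1)·(Lc⁻¹)^{n+1}`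

NOT IN PRINT; OUR BOOKKEEPING (G-an2-4 formalisation swarm → CRUX TEAM (2), leaf prover `b2b-balaban-gan24-formalise-leaf-03`, gen 55; (C4)-V typist of record per the OWNER's
W17, journal `CLAIMS.log` l.34977).  OUR PROOF ATTEMPT of the V analogue of the count BORNSEC-PLAN v1.1 §0 (c) for ONE lineage; [folklore] bookkeeping over this seat's (B2) ∕ (B3),
leaf-02 g48's `BornLambdaContactLineage` §1 (`units_le`, `polyS_le`) and its letter plumbing (`Push3LegTelescope.abs_le_of_env' ∕ summable_of_env'`, leaf-01's
`ContactGaugeStaircase.gauge_eq_staircase ∕ abs_gaugePiece_le`, `BornLambdaLineage.legChain_sub_respStep_of_lt`), leaf-01's `Push3.isFF_push₃`, leaf-02's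
`ContactBorderCommutator.push₃_reslot_smul`, leaf-04's `Push3LegTelescope.push₃_neg_left` BY NAME.  `d = 3` throughout (§1 generic).  0 `def`, 0 cited facts, 0 `def … : Prop`,
0 sorry; NO estimate of Bałaban's is discharged here — the letters ((N1), the dressed envelope, the two multiplier-leg tents) are HYPOTHESES; (D) `BornBorderContactBound` discharges them.
HONEST FRAMING (cell contract, verbatim): «discharging `BetaPertH` makes Bałaban's UV stability UNCONDITIONAL — a real milestone — but is NOT existence of continuum YM on T⁴ and NOT
the Clay problem.»  This file discharges nothing: NOT (C4)-V closed, NOT hB of the V half, NEVER «G-an2-4 closed», NOT (CONV-C), NOT D1, NOT `BetaPertH`.  HONEST DEPENDENCY: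
continuum YM on T⁴ ⇐ BetaPertH ∧ nine spine estimates (0/9 proved); BetaPertH ⇐ (D1) ∧ (D4) ∧ CAP+tail; G-an2-4 gates asym, D1 and NE2/3/4.

WHAT IS PROVED.
* §1 `exp_recenter_right_le ∕ exp_recenter_left_le` — the cells' envelopes, centred at the table site (`z′` for the fm cell, `x′` for the mf cell), re-centred at the output site
  `u′` at half the rate (one triangle inequality).
* §2 `abs_weight_mul_contact_v_le_three` — **THE WEIGHTED CONTACT ENTRY OF ONE V LINEAGE** (`2 ≤ Lc`, in-block root, birth level `i`, `n+1` levels up, pin `|cE| ≤ Lc^4`): legs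
  `T_i = legChain (respStepBmSeq ρ Lc) i n` (dressed envelope `K_E, κ_E`), `B_i = respStep (Lc^i) (Lc^{i+n+1})` ((N1) raw letter `C₁, κ₁`), abstract multiplier legs `M` (fm, summable
  in the packed slot) and `M′` (mf, bounded and summable) under the TENT letter `T_b·((Lc^n)^7)⁻¹·e^{−δ_K‖quo (Lc^n) y − ·‖∞}` at the packed sites; table `V = cVH • vhSAt ρ`.  THEN, with
  `κ = min δ_K κ₁`, for ALL `κ′ u′ x z a b`:
  `|(cE·Lc^8)^{n+1}·(((push₃ (−T_i) M T_i S − push₃ (−B_i) M B_i S) + (push₃ M′ T_i T_i S′ − push₃ M′ B_i B_i S′)) κ′ u′ x z a b)| ≤ |cVH|·C_fin·((n+1)·(Lc⁻¹)^{n+1})·e^{−(κ∕96)(|x−u′|₁ + |z−u′|₁)}`,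
  `S = reslot inl inr V`, `S′ = reslot inr inl V`, `C_fin = 2·Lc^3·((Lc^4)⁻¹·(4·T_b·(e^{8κ})²·Cnt)·(C₁²·(Lc·(64 + 544Lc + 768Lc²)))·Zl 4 (κ∕16))` — (B2) ∕ (B3) on the `inl∕inl` block
  (their polynomial `2K_B(2α_g + 2α_g·Lc·n) + (4α_g² + 8α_g²·Lc·n)` is termwise below leaf-02's `polyS`), `isFF_push₃` on the others, `units_le` for the powers
  (`Lc^{12(n+1)}·(Lc^n)^{−7}·(Lc^{5(n+1)})^{−2}·(Lc^n)^4 ≤ Lc^3·(Lc⁻¹)^{n+1}`).  This is the summand shape of (C1) `BornBorderContactNest.contact_v_eq_of_succ ∕ _of_top`.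
-/

open scoped BigOperators
open Literature.MathematicalPhysics.QuantumFieldTheory
open Literature.MathematicalPhysics.QuantumFieldTheory.LatticeForm (quo)
open Literature.MathematicalPhysics.QuantumFieldTheory.Balaban1983to89
open Literature.MathematicalPhysics.QuantumFieldTheory.Balaban1983to89.Beta
open B4ContourShift (supNorm supNorm_nonneg exists_supNorm_eq abs_le_supNorm)
open B4TorusKernel (supNorm_neg)
open B12Sec2to5 (l1 l1_nonneg)
open ExpKernelCalculus (MKer Zl Zl_nonneg)
open AffineAveraging (Form0 Form1 Site box toSite unitVec dz)
open AveragingContours (blk)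
open AveragingHessianKernels (ell)
open AveragingHessianKernelsRooted (vhSAt)
open OneStepResolventKernel (Fib)
open KKTFluctuationKernel (delta1)
open BalabanCompositeJets (respStep)
open Summit.QuantumFields.BalabanUV.Beta.AxialProjectorBlockMean (bmGaugeAt)
open Summit.QuantumFields.BalabanUV.Beta.GAN24.RespStepBmDecompLegs (legAct)
open Summit.QuantumFields.BalabanUV.Beta.GAN24.RespStepBmDecompPsi (Psi)
open Summit.QuantumFields.BalabanUV.Beta.GAN24.RespStepBmDecompExact (respStepBmSeq)
open Summit.QuantumFields.BalabanUV.Beta.GAN24.Push4Iter (legChain)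
open Summit.QuantumFields.BalabanUV.Beta.GAN24.Push3 (push₃ isFF_push₃)
open Summit.QuantumFields.BalabanUV.Beta.GAN24.Push3LegTelescope (push₃_neg_left abs_le_of_env' summable_of_env')
open Summit.QuantumFields.BalabanUV.Beta.GAN24.SrecLinearPartEq (reslot)
open Summit.QuantumFields.BalabanUV.Beta.GAN24.ContactGaugeStaircase (gauge_eq_staircase abs_gaugePiece_le)
open Summit.QuantumFields.BalabanUV.Beta.GAN24.ContactLambdaCellBound (exp_env_mono_rate exp_supNorm_add_le_exp_l1)
open Summit.QuantumFields.BalabanUV.Beta.GAN24.ContactBorderCommutator (push₃_reslot_smul)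
open Summit.QuantumFields.BalabanUV.Beta.GAN24.ContactBorderEntryBound (abs_contact_border_fm_le)
open Summit.QuantumFields.BalabanUV.Beta.GAN24.ContactBorderEntryBoundMf (abs_contact_border_mf_le)
open Summit.QuantumFields.BalabanUV.Beta.GAN24.BornLambdaLineage (legChain_sub_respStep_of_lt)
open Summit.QuantumFields.BalabanUV.Beta.GAN24.BornLambdaContactLineage (units_le polyS_le)

namespace Summit.QuantumFields.BalabanUV.Beta.GAN24.BornBorderContactLineage

/-! ## §1 Re-centring the cells' envelopes at the output site -/

/-- [folklore] `e^{−c(‖x−z‖∞ + ‖u′−z‖∞)} ≤ e^{−(c∕2)(‖x−u′‖∞ + ‖z−u′‖∞)}` (`c ≥ 0`; `‖x−u′‖∞ ≤ ‖x−z‖∞ + ‖z−u′‖∞`). -/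
theorem exp_recenter_right_le {d : ℕ} {c : ℝ} (hc : 0 ≤ c) (x z u' : Site (d + 1)) :
    Real.exp (-c * (supNorm (x - z) + supNorm (u' - z))) ≤ Real.exp (-(c / 2) * (supNorm (x - u') + supNorm (z - u'))) := by
  rw [Real.exp_le_exp]
  -- the triangle inequality of the sup norm, from its definition (an5's `exists_supNorm_eq ∕ abs_le_supNorm`)
  have h1 : supNorm (x - u') ≤ supNorm (x - z) + supNorm (z - u') := by
    have e : x - u' = (x - z) + (z - u') := by abel
    obtain ⟨j, hj⟩ := exists_supNorm_eq (x - u')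
    rw [hj]
    have hxj : (x - u') j = (x - z) j + (z - u') j := by rw [e, Pi.add_apply]
    have habs : ((|(x - u') j| : ℤ) : ℝ) ≤ ((|(x - z) j| : ℤ) : ℝ) + ((|(z - u') j| : ℤ) : ℝ) := by
      rw [hxj]; exact_mod_cast abs_add_le ((x - z) j) ((z - u') j)
    exact habs.trans (add_le_add (abs_le_supNorm (x - z) j) (abs_le_supNorm (z - u') j))
  have h2 : supNorm (u' - z) = supNorm (z - u') := by rw [← neg_sub, supNorm_neg]
  have hA : 0 ≤ supNorm (x - z) := supNorm_nonneg _
  have hB : 0 ≤ supNorm (z - u') := supNorm_nonneg _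
  rw [h2]
  nlinarith [mul_le_mul_of_nonneg_left h1 (by positivity : (0 : ℝ) ≤ c / 2), mul_nonneg hc hA, mul_nonneg hc hB]

/-- [folklore] The same for an envelope centred at the first kernel site: `e^{−c(‖z−x‖∞ + ‖u′−x‖∞)} ≤ e^{−(c∕2)(‖x−u′‖∞ + ‖z−u′‖∞)}`. -/
theorem exp_recenter_left_le {d : ℕ} {c : ℝ} (hc : 0 ≤ c) (x z u' : Site (d + 1)) :
    Real.exp (-c * (supNorm (z - x) + supNorm (u' - x))) ≤ Real.exp (-(c / 2) * (supNorm (x - u') + supNorm (z - u'))) := by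
  have h := exp_recenter_right_le hc z x u'
  rwa [add_comm (supNorm (z - u'))] at h

/-! ## §2 The weighted contact entry of one V lineage -/

section Lineage

variable {Lc : ℕ} [NeZero Lc]
variable {rr : Fin (3 + 1) → ℕ} {i n : ℕ} {cE cVH : ℝ} {C₁ κ₁ KE κE CM' Tb δK : ℝ}
  {M M' : Fin (3 + 1) → (Fin (3 + 1) → ℤ) → Fin (3 + 1) → (Fin (3 + 1) → ℤ) → ℝ}

/-- NOT IN PRINT; OUR PROOF ATTEMPT of the V analogue of the count BORNSEC-PLAN v1.1 §0 (c) for ONE lineage, every letter a HYPOTHESIS with explicit constants.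
**THE WEIGHTED CONTACT ENTRY OF ONE V LINEAGE** (`d = 3`, `2 ≤ Lc`, in-block root; birth level `i`, `n+1` levels up): legs `T_i = legChain (respStepBmSeq ρ Lc) i n` (dressed envelope
`K_E, κ_E`) and `B_i = respStep (Lc^i) (Lc^{i+n+1})` ((N1) raw letter `C₁, κ₁`), the route's bond gauge functions (staircase `gauge_eq_staircase`, pieces `abs_gaugePiece_le`), an fm
multiplier leg `M` (summable in the packed slot) and an mf multiplier leg `M′` (bounded, summable), both under the TENT letter `T_b·((Lc^n)^7)⁻¹·e^{−δ_K‖quo (Lc^n) y − ·‖∞}` at the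
packed sites `Lc•y`; table `V = cVH • vhSAt ρ`; weight `(cE·Lc^8)^{n+1}`, `|cE| ≤ Lc^4`.  THEN, with `κ = min δ_K κ₁`, for ALL `κ′ u′ x z a b`:
`|(cE·Lc^8)^{n+1}·((push₃ (−T_i) M T_i S − push₃ (−B_i) M B_i S) + (push₃ M′ T_i T_i S′ − push₃ M′ B_i B_i S′)) κ′u′ x z a b| ≤ |cVH|·C_fin·((n+1)·(Lc⁻¹)^{n+1})·e^{−(κ∕96)(|x−u′|₁ + |z−u′|₁)}`,
`S = reslot inl inr V`, `S′ = reslot inr inl V`, `C_fin = 2·Lc^3·((Lc^4)⁻¹·(4·T_b·(e^{8κ})²·Cnt)·(C₁²·(Lc·(64 + 544Lc + 768Lc²)))·Zl 4 (κ∕16))` — (B2) ∕ (B3) on the `inl∕inl` block,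
`isFF_push₃` on the others, leaf-02's `units_le ∕ polyS_le` for the powers and the polynomial. -/
theorem abs_weight_mul_contact_v_le_three (hLc : 2 ≤ Lc) (hrr : rr ∈ box (3 + 1) Lc) (hcE : |cE| ≤ (Lc : ℝ) ^ 4)
    (hN1 : ∀ (m k : ℕ) (μ : Fin (3 + 1)) (z : Site (3 + 1)) (l'' : Fin (3 + 1)) (w' : Site (3 + 1)),
      |respStep (d := 3) (Lc ^ m) (Lc ^ (m + k + 1)) μ z l'' w'| ≤
        C₁ * ((Lc : ℝ) ^ (5 * (k + 1)))⁻¹ * Real.exp (-(κ₁ * supNorm (quo (Lc ^ (k + 1)) w' - z))))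
    (hκ₁ : 0 < κ₁) (hC₁ : 0 ≤ C₁)
    (hE : ∀ μ z l u, |legChain (respStepBmSeq (d := 3) (toSite rr) Lc) i n μ z l u| ≤ KE * Real.exp (-(κE * supNorm (quo (Lc ^ (n + 1)) u - z))))
    (hκE : 0 < κE)
    (hMs : ∀ a b μ, Summable fun z => M a b μ z)
    (hMt : ∀ (a : Fin (3 + 1)) (b : Site (3 + 1)) (μ : Fin (3 + 1)) (y : Site (3 + 1)),
      |M a b μ ((Lc : ℤ) • y)| ≤ Tb * ((((Lc : ℝ) ^ n) ^ (2 * 3 + 1))⁻¹) * Real.exp (-(δK * supNorm (quo (Lc ^ n) y - b))))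
    (hM'b : ∀ a b μ z, |M' a b μ z| ≤ CM') (hM's : ∀ a b μ, Summable fun z => M' a b μ z)
    (hM't : ∀ (a : Fin (3 + 1)) (b : Site (3 + 1)) (μ : Fin (3 + 1)) (y : Site (3 + 1)),
      |M' a b μ ((Lc : ℤ) • y)| ≤ Tb * ((((Lc : ℝ) ^ n) ^ (2 * 3 + 1))⁻¹) * Real.exp (-(δK * supNorm (quo (Lc ^ n) y - b))))
    (hδK : 0 < δK) (hTb : 0 ≤ Tb)
    (κ' : Fin (3 + 1)) (u' x z : Site (3 + 1)) (a b : Fib 3) :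
    |(cE * (Lc : ℝ) ^ (2 * (3 + 1))) ^ (n + 1) *
        ((push₃ (-legChain (respStepBmSeq (d := 3) (toSite rr) Lc) i n) M (legChain (respStepBmSeq (d := 3) (toSite rr) Lc) i n)
              (reslot Sum.inl Sum.inr fun κ u => cVH • vhSAt (toSite rr) 3 Lc rfl κ u) κ' u' x z a b
            - push₃ (-respStep (d := 3) (Lc ^ i) (Lc ^ (i + n + 1))) M (respStep (d := 3) (Lc ^ i) (Lc ^ (i + n + 1)))
              (reslot Sum.inl Sum.inr fun κ u => cVH • vhSAt (toSite rr) 3 Lc rfl κ u) κ' u' x z a b)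
          + (push₃ M' (legChain (respStepBmSeq (d := 3) (toSite rr) Lc) i n) (legChain (respStepBmSeq (d := 3) (toSite rr) Lc) i n)
              (reslot Sum.inr Sum.inl fun κ u => cVH • vhSAt (toSite rr) 3 Lc rfl κ u) κ' u' x z a b
            - push₃ M' (respStep (d := 3) (Lc ^ i) (Lc ^ (i + n + 1))) (respStep (d := 3) (Lc ^ i) (Lc ^ (i + n + 1)))
              (reslot Sum.inr Sum.inl fun κ u => cVH • vhSAt (toSite rr) 3 Lc rfl κ u) κ' u' x z a b))|
      ≤ |cVH| * (2 * ((Lc : ℝ) ^ 3 * (((Lc : ℝ) ^ (3 + 1))⁻¹ * (((3 : ℝ) + 1) * Tb * (Real.exp (2 * ((3 : ℝ) + 1) * min δK κ₁) ^ 2 *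
              (((2 * Lc : ℕ) : ℝ) ^ (3 + 1) * (((3 + 1 : ℕ) : ℝ) * ((Lc : ℝ) ^ (3 + 1) * (ell (3 + 1) Lc : ℝ))))))
            * (C₁ ^ 2 * ((Lc : ℝ) * (64 + 544 * Lc + 768 * (Lc : ℝ) ^ 2))) * Zl (3 + 1) (min δK κ₁ / (4 * ((3 : ℝ) + 1))))))
          * ((((n : ℝ) + 1)) * ((Lc : ℝ)⁻¹) ^ (n + 1))
          * Real.exp (-(min δK κ₁ / 12 / 2 / ((3 : ℝ) + 1)) * (l1 (x - u') + l1 (z - u'))) := by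
  have hLc1 : 1 ≤ Lc := le_trans (by norm_num) hLc
  have hL : (0 : ℝ) < (Lc : ℝ) := Nat.cast_pos.2 (Nat.pos_of_ne_zero (NeZero.ne Lc))
  have hLn1 : 1 ≤ Lc ^ (n + 1) := Nat.one_le_pow _ _ hLc1
  set κ : ℝ := min δK κ₁ with hκdef
  have hκ : 0 < κ := lt_min hδK hκ₁
  have hκK : κ ≤ δK := min_le_left _ _
  have hκ1 : κ ≤ κ₁ := min_le_right _ _
  -- the field-slot letters at the common rate `κ`
  set T := legChain (respStepBmSeq (d := 3) (toSite rr) Lc) i n with hTdef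
  set B := respStep (d := 3) (Lc ^ i) (Lc ^ (i + n + 1)) with hBdef
  have hT : ∀ μ z' l u, |T μ z' l u| ≤ KE := abs_le_of_env' hκE.le hE
  have hTs : ∀ μ z' l, Summable fun u => T μ z' l u := summable_of_env' hLn1 hκE hE
  have hB : ∀ μ z' l u, |B μ z' l u| ≤ C₁ * ((Lc : ℝ) ^ (5 * (n + 1)))⁻¹ * Real.exp (-(κ * supNorm (quo (Lc ^ (n + 1)) u - z'))) := by
    intro μ z' l u
    exact (hN1 i n μ z' l u).trans (mul_le_mul_of_nonneg_left (exp_env_mono_rate hκ1 (supNorm_nonneg _)) (by positivity))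
  -- the gauge functions and their staircase pieces (leaf-02 g48's plumbing, verbatim)
  set lam : Fin (3 + 1) → Site (3 + 1) → Site (3 + 1) → ℝ := fun μ z' =>
    Psi (toSite rr) Lc i n (delta1 μ z') - bmGaugeAt (toSite rr) (respStep (d := 3) (Lc ^ i) (Lc ^ (i + n + 1)) μ z') Lc with hlamdef
  set Gp : Fin (3 + 1) → Site (3 + 1) → ℕ → Site (3 + 1) → ℝ := fun μ₀ z₀ s y =>
    if s = 0 then -bmGaugeAt (toSite rr) (respStep (d := 3) (Lc ^ i) (Lc ^ (i + n + 1)) μ₀ z₀) Lc y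
    else -(((Lc : ℝ) ^ ((3 + 1) * s))⁻¹ *
      bmGaugeAt (toSite rr) (legAct (respStep (d := 3) (Lc ^ (i + s)) (Lc ^ (i + n + 1))) (delta1 μ₀ z₀)) Lc y) with hGpdef
  have hTB : T - B = fun μ z' l u => dz (lam μ z') l u := by
    have hik : i < i + n + 1 := by omega
    have h := legChain_sub_respStep_of_lt (d := 3) (Lc := Lc) hrr hik
    rw [show i + n + 1 - 1 - i = n by omega] at h
    exact h
  have hψ : ∀ (μ₀ : Fin (3 + 1)) (z₀ u : Site (3 + 1)), lam μ₀ z₀ u = ∑ s ∈ Finset.range (n + 1), Gp μ₀ z₀ s (blk (Lc ^ s) u) := by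
    intro μ₀ z₀ u
    have h := gauge_eq_staircase (Lc := Lc) (toSite rr) i n μ₀ z₀ u
    simp only [hlamdef, hGpdef, Pi.sub_apply] at h ⊢
    exact h
  have hG : ∀ (μ₀ : Fin (3 + 1)) (z₀ : Site (3 + 1)) (s : ℕ), s ≤ n → ∀ u : Site (3 + 1),
      |Gp μ₀ z₀ s (blk (Lc ^ s) u)| ≤ (8 * (Lc : ℝ) * C₁ * ((Lc : ℝ) ^ (5 * (n + 1)))⁻¹) * (Lc : ℝ) ^ s * Real.exp (-(κ * supNorm (quo (Lc ^ (n + 1)) u - z₀))) := by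
    intro μ₀ z₀ s hs u
    have h := abs_gaugePiece_le (Lc := Lc) hN1 hrr i n μ₀ z₀ hs u
    simp only [hGpdef] at h ⊢
    refine h.trans (mul_le_mul_of_nonneg_left (exp_env_mono_rate hκ1 (supNorm_nonneg _)) (by positivity))
  -- the two tents at the common rate
  have hMt' : ∀ (a : Fin (3 + 1)) (b : Site (3 + 1)) (μ : Fin (3 + 1)) (y : Site (3 + 1)),
      |M a b μ ((Lc : ℤ) • y)| ≤ (Tb * ((((Lc : ℝ) ^ n) ^ (2 * 3 + 1))⁻¹)) * Real.exp (-(κ * supNorm (quo (Lc ^ n) y - b))) := fun a b μ y =>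
    (hMt a b μ y).trans (mul_le_mul_of_nonneg_left (exp_env_mono_rate hκK (supNorm_nonneg _)) (by positivity))
  have hM't' : ∀ (a : Fin (3 + 1)) (b : Site (3 + 1)) (μ : Fin (3 + 1)) (y : Site (3 + 1)),
      |M' a b μ ((Lc : ℤ) • y)| ≤ (Tb * ((((Lc : ℝ) ^ n) ^ (2 * 3 + 1))⁻¹)) * Real.exp (-(κ * supNorm (quo (Lc ^ n) y - b))) := fun a b μ y =>
    (hM't a b μ y).trans (mul_le_mul_of_nonneg_left (exp_env_mono_rate hκK (supNorm_nonneg _)) (by positivity))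
  -- the scale `cVH` and the sign of the fm pushes out; entries
  simp only [push₃_reslot_smul, push₃_neg_left]
  simp only [Pi.smul_apply, Pi.neg_apply, smul_eq_mul]
  set P₁ := push₃ T M T (reslot Sum.inl Sum.inr (vhSAt (toSite rr) 3 Lc rfl)) κ' u' with hP₁
  set P₂ := push₃ B M B (reslot Sum.inl Sum.inr (vhSAt (toSite rr) 3 Lc rfl)) κ' u' with hP₂
  set P₃ := push₃ M' T T (reslot Sum.inr Sum.inl (vhSAt (toSite rr) 3 Lc rfl)) κ' u' with hP₃
  set P₄ := push₃ M' B B (reslot Sum.inr Sum.inl (vhSAt (toSite rr) 3 Lc rfl)) κ' u' with hP₄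
  have e : (cE * (Lc : ℝ) ^ (2 * (3 + 1))) ^ (n + 1) * (cVH * -P₁ x z a b - cVH * -P₂ x z a b + (cVH * P₃ x z a b - cVH * P₄ x z a b))
      = ((cE * (Lc : ℝ) ^ (2 * (3 + 1))) ^ (n + 1) * cVH) * ((P₃ x z a b - P₄ x z a b) - (P₁ x z a b - P₂ x z a b)) := by ring
  rw [e, abs_mul, abs_mul, abs_pow]
  -- the tables are ff-valued
  have hS1 : Push4.IsFF P₁ := isFF_push₃ (l := T) (r := M) (w := T) (reslot Sum.inl Sum.inr (vhSAt (toSite rr) 3 Lc rfl)) κ' u'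
  have hS2 : Push4.IsFF P₂ := isFF_push₃ (l := B) (r := M) (w := B) (reslot Sum.inl Sum.inr (vhSAt (toSite rr) 3 Lc rfl)) κ' u'
  have hS3 : Push4.IsFF P₃ := isFF_push₃ (l := M') (r := T) (w := T) (reslot Sum.inr Sum.inl (vhSAt (toSite rr) 3 Lc rfl)) κ' u'
  have hS4 : Push4.IsFF P₄ := isFF_push₃ (l := M') (r := B) (w := B) (reslot Sum.inr Sum.inl (vhSAt (toSite rr) 3 Lc rfl)) κ' u'
  have hZ : 0 ≤ Zl (3 + 1) (κ / (4 * ((3 : ℝ) + 1))) := Zl_nonneg (by positivity)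
  have hRHS0 : 0 ≤ |cVH| * (2 * ((Lc : ℝ) ^ 3 * (((Lc : ℝ) ^ (3 + 1))⁻¹ * (((3 : ℝ) + 1) * Tb * (Real.exp (2 * ((3 : ℝ) + 1) * κ) ^ 2 *
              (((2 * Lc : ℕ) : ℝ) ^ (3 + 1) * (((3 + 1 : ℕ) : ℝ) * ((Lc : ℝ) ^ (3 + 1) * (ell (3 + 1) Lc : ℝ))))))
            * (C₁ ^ 2 * ((Lc : ℝ) * (64 + 544 * Lc + 768 * (Lc : ℝ) ^ 2))) * Zl (3 + 1) (κ / (4 * ((3 : ℝ) + 1))))))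
          * ((((n : ℝ) + 1)) * ((Lc : ℝ)⁻¹) ^ (n + 1))
          * Real.exp (-(κ / 12 / 2 / ((3 : ℝ) + 1)) * (l1 (x - u') + l1 (z - u'))) := by positivity
  rcases a with α | μa
  · rcases b with β | νb
    · -- the cells: (B2) on the fm pair, (B3) on the mf pair
      have hfm := abs_contact_border_fm_le (d := 3) (Lc := Lc) (rr := rr) (n := n)
        (αg := 8 * (Lc : ℝ) * C₁ * ((Lc : ℝ) ^ (5 * (n + 1)))⁻¹) (KB := C₁ * ((Lc : ℝ) ^ (5 * (n + 1)))⁻¹)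
        (Tb := Tb * ((((Lc : ℝ) ^ n) ^ (2 * 3 + 1))⁻¹)) (lam := lam) (G := Gp) hLc1 hrr hκ (by positivity) (by positivity) (by positivity)
        hT hTs hB hTB hψ hG hMs hMt' κ' u' x z α β
      have hmf := abs_contact_border_mf_le (d := 3) (Lc := Lc) (rr := rr) (n := n)
        (αg := 8 * (Lc : ℝ) * C₁ * ((Lc : ℝ) ^ (5 * (n + 1)))⁻¹) (KB := C₁ * ((Lc : ℝ) ^ (5 * (n + 1)))⁻¹)
        (Tb := Tb * ((((Lc : ℝ) ^ n) ^ (2 * 3 + 1))⁻¹)) (lam := lam) (G := Gp) hLc1 hrr hκ (by positivity) (by positivity) (by positivity)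
        hT hTs hB hTB hψ hG hM'b hM's hM't' κ' u' x z α β
      -- |mf − fm| ≤ |mf| + |fm|
      refine (mul_le_mul_of_nonneg_left ((abs_sub _ _).trans (add_le_add hmf hfm)) (by positivity)).trans ?_
      -- the polynomial against leaf-02's, the envelopes re-centred at `u′` in `ℓ¹` currency
      have hX : (0 : ℝ) < (Lc : ℝ) ^ (5 * (n + 1)) := by positivity
      have hP := polyS_le (Lc := Lc) (C₁ := C₁) hX n
      have hdiff : (2 * (C₁ * ((Lc : ℝ) ^ (5 * (n + 1)))⁻¹) * (4 * (8 * (Lc : ℝ) * C₁ * ((Lc : ℝ) ^ (5 * (n + 1)))⁻¹)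
              + 2 * (8 * (Lc : ℝ) * C₁ * ((Lc : ℝ) ^ (5 * (n + 1)))⁻¹) * Lc * n)
            + (8 * (8 * (Lc : ℝ) * C₁ * ((Lc : ℝ) ^ (5 * (n + 1)))⁻¹) ^ 2 + 2 * (6 * (8 * (Lc : ℝ) * C₁ * ((Lc : ℝ) ^ (5 * (n + 1)))⁻¹) ^ 2) * Lc * n))
          - (2 * (C₁ * ((Lc : ℝ) ^ (5 * (n + 1)))⁻¹) * (2 * (8 * (Lc : ℝ) * C₁ * ((Lc : ℝ) ^ (5 * (n + 1)))⁻¹)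
              + 2 * (8 * (Lc : ℝ) * C₁ * ((Lc : ℝ) ^ (5 * (n + 1)))⁻¹) * Lc * n)
            + (4 * (8 * (Lc : ℝ) * C₁ * ((Lc : ℝ) ^ (5 * (n + 1)))⁻¹) ^ 2 + 2 * (4 * (8 * (Lc : ℝ) * C₁ * ((Lc : ℝ) ^ (5 * (n + 1)))⁻¹) ^ 2) * Lc * n))
          = 2 * (C₁ * ((Lc : ℝ) ^ (5 * (n + 1)))⁻¹) * (2 * (8 * (Lc : ℝ) * C₁ * ((Lc : ℝ) ^ (5 * (n + 1)))⁻¹))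
            + (4 * (8 * (Lc : ℝ) * C₁ * ((Lc : ℝ) ^ (5 * (n + 1)))⁻¹) ^ 2
              + 4 * (8 * (Lc : ℝ) * C₁ * ((Lc : ℝ) ^ (5 * (n + 1)))⁻¹) ^ 2 * Lc * n) := by ring
      have hdiff0 : 0 ≤ 2 * (C₁ * ((Lc : ℝ) ^ (5 * (n + 1)))⁻¹) * (2 * (8 * (Lc : ℝ) * C₁ * ((Lc : ℝ) ^ (5 * (n + 1)))⁻¹))
            + (4 * (8 * (Lc : ℝ) * C₁ * ((Lc : ℝ) ^ (5 * (n + 1)))⁻¹) ^ 2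
              + 4 * (8 * (Lc : ℝ) * C₁ * ((Lc : ℝ) ^ (5 * (n + 1)))⁻¹) ^ 2 * Lc * n) := by positivity
      have hPoly : 2 * (C₁ * ((Lc : ℝ) ^ (5 * (n + 1)))⁻¹) * (2 * (8 * (Lc : ℝ) * C₁ * ((Lc : ℝ) ^ (5 * (n + 1)))⁻¹)
              + 2 * (8 * (Lc : ℝ) * C₁ * ((Lc : ℝ) ^ (5 * (n + 1)))⁻¹) * Lc * n)
            + (4 * (8 * (Lc : ℝ) * C₁ * ((Lc : ℝ) ^ (5 * (n + 1)))⁻¹) ^ 2 + 2 * (4 * (8 * (Lc : ℝ) * C₁ * ((Lc : ℝ) ^ (5 * (n + 1)))⁻¹) ^ 2) * Lc * n)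
          ≤ C₁ ^ 2 * (((Lc : ℝ) ^ (5 * (n + 1)))⁻¹) ^ 2 * (((n : ℝ) + 1) * ((Lc : ℝ) * (64 + 544 * Lc + 768 * (Lc : ℝ) ^ 2))) := by
        linarith
      have hEXz : Real.exp (-(κ / 12) * (supNorm (x - z) + supNorm (u' - z)))
          ≤ Real.exp (-(κ / 12 / 2 / ((3 : ℝ) + 1)) * (l1 (x - u') + l1 (z - u'))) :=
        (exp_recenter_right_le (c := κ / 12) (by positivity) x z u').trans
          (exp_supNorm_add_le_exp_l1 (d := 3) (c := κ / 12 / 2) (by positivity) (x - u') (z - u'))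
      have hEXx : Real.exp (-(κ / 12) * (supNorm (z - x) + supNorm (u' - x)))
          ≤ Real.exp (-(κ / 12 / 2 / ((3 : ℝ) + 1)) * (l1 (x - u') + l1 (z - u'))) :=
        (exp_recenter_left_le (c := κ / 12) (by positivity) x z u').trans
          (exp_supNorm_add_le_exp_l1 (d := 3) (c := κ / 12 / 2) (by positivity) (x - u') (z - u'))
      -- each cell bound ≤ the same cell bound with leaf-02's polynomial and the re-centred envelope
      have key : ∀ {EX : ℝ}, 0 ≤ EX → EX ≤ Real.exp (-(κ / 12 / 2 / ((3 : ℝ) + 1)) * (l1 (x - u') + l1 (z - u'))) →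
          ((Lc : ℝ) ^ (3 + 1))⁻¹ *
              ((((3 : ℝ) + 1) * (Tb * ((((Lc : ℝ) ^ n) ^ (2 * 3 + 1))⁻¹)) * (Real.exp (2 * ((3 : ℝ) + 1) * κ) ^ 2 *
                  (((2 * Lc : ℕ) : ℝ) ^ (3 + 1) * (((3 + 1 : ℕ) : ℝ) * ((Lc : ℝ) ^ (3 + 1) * (ell (3 + 1) Lc : ℝ))))))
                * (2 * (C₁ * ((Lc : ℝ) ^ (5 * (n + 1)))⁻¹) * (2 * (8 * (Lc : ℝ) * C₁ * ((Lc : ℝ) ^ (5 * (n + 1)))⁻¹)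
                      + 2 * (8 * (Lc : ℝ) * C₁ * ((Lc : ℝ) ^ (5 * (n + 1)))⁻¹) * Lc * n)
                    + (4 * (8 * (Lc : ℝ) * C₁ * ((Lc : ℝ) ^ (5 * (n + 1)))⁻¹) ^ 2
                      + 2 * (4 * (8 * (Lc : ℝ) * C₁ * ((Lc : ℝ) ^ (5 * (n + 1)))⁻¹) ^ 2) * Lc * n))
                * ((((Lc ^ n : ℕ) : ℝ)) ^ (3 + 1) * Zl (3 + 1) (κ / (4 * ((3 : ℝ) + 1))))
                * EX)
            ≤ ((Lc : ℝ) ^ (3 + 1))⁻¹ *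
              ((((3 : ℝ) + 1) * (Tb * ((((Lc : ℝ) ^ n) ^ (2 * 3 + 1))⁻¹)) * (Real.exp (2 * ((3 : ℝ) + 1) * κ) ^ 2 *
                  (((2 * Lc : ℕ) : ℝ) ^ (3 + 1) * (((3 + 1 : ℕ) : ℝ) * ((Lc : ℝ) ^ (3 + 1) * (ell (3 + 1) Lc : ℝ))))))
                * (C₁ ^ 2 * (((Lc : ℝ) ^ (5 * (n + 1)))⁻¹) ^ 2 * (((n : ℝ) + 1) * ((Lc : ℝ) * (64 + 544 * Lc + 768 * (Lc : ℝ) ^ 2))))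
                * ((((Lc ^ n : ℕ) : ℝ)) ^ (3 + 1) * Zl (3 + 1) (κ / (4 * ((3 : ℝ) + 1))))
                * Real.exp (-(κ / 12 / 2 / ((3 : ℝ) + 1)) * (l1 (x - u') + l1 (z - u')))) := by
        intro EX hEX0 hEX
        gcongr
      refine (mul_le_mul_of_nonneg_left (add_le_add (key (Real.exp_pos _).le hEXx) (key (Real.exp_pos _).le hEXz)) (by positivity)).trans ?_
      -- the powers: `units_le`
      have hU := units_le (Lc := Lc) hcE n
      have hR0 : 0 ≤ |cVH| * (2 * (((Lc : ℝ) ^ (3 + 1))⁻¹ * (((3 : ℝ) + 1) * Tb * (Real.exp (2 * ((3 : ℝ) + 1) * κ) ^ 2 *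
              (((2 * Lc : ℕ) : ℝ) ^ (3 + 1) * (((3 + 1 : ℕ) : ℝ) * ((Lc : ℝ) ^ (3 + 1) * (ell (3 + 1) Lc : ℝ))))))
            * (C₁ ^ 2 * ((Lc : ℝ) * (64 + 544 * Lc + 768 * (Lc : ℝ) ^ 2))) * Zl (3 + 1) (κ / (4 * ((3 : ℝ) + 1)))))
          * (((n : ℝ) + 1)) * Real.exp (-(κ / 12 / 2 / ((3 : ℝ) + 1)) * (l1 (x - u') + l1 (z - u'))) := by positivity
      calc |cE * (Lc : ℝ) ^ (2 * (3 + 1))| ^ (n + 1) * |cVH| *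
            (((Lc : ℝ) ^ (3 + 1))⁻¹ *
              ((((3 : ℝ) + 1) * (Tb * ((((Lc : ℝ) ^ n) ^ (2 * 3 + 1))⁻¹)) * (Real.exp (2 * ((3 : ℝ) + 1) * κ) ^ 2 *
                  (((2 * Lc : ℕ) : ℝ) ^ (3 + 1) * (((3 + 1 : ℕ) : ℝ) * ((Lc : ℝ) ^ (3 + 1) * (ell (3 + 1) Lc : ℝ))))))
                * (C₁ ^ 2 * (((Lc : ℝ) ^ (5 * (n + 1)))⁻¹) ^ 2 * (((n : ℝ) + 1) * ((Lc : ℝ) * (64 + 544 * Lc + 768 * (Lc : ℝ) ^ 2))))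
                * ((((Lc ^ n : ℕ) : ℝ)) ^ (3 + 1) * Zl (3 + 1) (κ / (4 * ((3 : ℝ) + 1))))
                * Real.exp (-(κ / 12 / 2 / ((3 : ℝ) + 1)) * (l1 (x - u') + l1 (z - u'))))
            + ((Lc : ℝ) ^ (3 + 1))⁻¹ *
              ((((3 : ℝ) + 1) * (Tb * ((((Lc : ℝ) ^ n) ^ (2 * 3 + 1))⁻¹)) * (Real.exp (2 * ((3 : ℝ) + 1) * κ) ^ 2 *
                  (((2 * Lc : ℕ) : ℝ) ^ (3 + 1) * (((3 + 1 : ℕ) : ℝ) * ((Lc : ℝ) ^ (3 + 1) * (ell (3 + 1) Lc : ℝ))))))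
                * (C₁ ^ 2 * (((Lc : ℝ) ^ (5 * (n + 1)))⁻¹) ^ 2 * (((n : ℝ) + 1) * ((Lc : ℝ) * (64 + 544 * Lc + 768 * (Lc : ℝ) ^ 2))))
                * ((((Lc ^ n : ℕ) : ℝ)) ^ (3 + 1) * Zl (3 + 1) (κ / (4 * ((3 : ℝ) + 1))))
                * Real.exp (-(κ / 12 / 2 / ((3 : ℝ) + 1)) * (l1 (x - u') + l1 (z - u')))))
          = (|cE * (Lc : ℝ) ^ (2 * (3 + 1))| ^ (n + 1) *
              (((((Lc : ℝ) ^ n) ^ (2 * 3 + 1))⁻¹ * ((((Lc : ℝ) ^ (5 * (n + 1)))⁻¹) ^ 2 * (((Lc ^ n : ℕ) : ℝ)) ^ (3 + 1)))))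
            * (|cVH| * (2 * (((Lc : ℝ) ^ (3 + 1))⁻¹ * (((3 : ℝ) + 1) * Tb * (Real.exp (2 * ((3 : ℝ) + 1) * κ) ^ 2 *
                (((2 * Lc : ℕ) : ℝ) ^ (3 + 1) * (((3 + 1 : ℕ) : ℝ) * ((Lc : ℝ) ^ (3 + 1) * (ell (3 + 1) Lc : ℝ))))))
              * (C₁ ^ 2 * ((Lc : ℝ) * (64 + 544 * Lc + 768 * (Lc : ℝ) ^ 2))) * Zl (3 + 1) (κ / (4 * ((3 : ℝ) + 1)))))
              * (((n : ℝ) + 1)) * Real.exp (-(κ / 12 / 2 / ((3 : ℝ) + 1)) * (l1 (x - u') + l1 (z - u')))) := by ring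
        _ ≤ ((Lc : ℝ) ^ 3 * ((Lc : ℝ)⁻¹) ^ (n + 1))
            * (|cVH| * (2 * (((Lc : ℝ) ^ (3 + 1))⁻¹ * (((3 : ℝ) + 1) * Tb * (Real.exp (2 * ((3 : ℝ) + 1) * κ) ^ 2 *
                (((2 * Lc : ℕ) : ℝ) ^ (3 + 1) * (((3 + 1 : ℕ) : ℝ) * ((Lc : ℝ) ^ (3 + 1) * (ell (3 + 1) Lc : ℝ))))))
              * (C₁ ^ 2 * ((Lc : ℝ) * (64 + 544 * Lc + 768 * (Lc : ℝ) ^ 2))) * Zl (3 + 1) (κ / (4 * ((3 : ℝ) + 1)))))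
              * (((n : ℝ) + 1)) * Real.exp (-(κ / 12 / 2 / ((3 : ℝ) + 1)) * (l1 (x - u') + l1 (z - u')))) :=
          mul_le_mul_of_nonneg_right hU hR0
        _ = _ := by ring
    · -- `b = inr`: every push is ff-valued
      rw [hS1.2 x z (Sum.inl α) νb, hS2.2 x z (Sum.inl α) νb, hS3.2 x z (Sum.inl α) νb, hS4.2 x z (Sum.inl α) νb]
      simp only [sub_self, abs_zero, mul_zero]
      exact hRHS0
  · rw [hS1.1 x z μa b, hS2.1 x z μa b, hS3.1 x z μa b, hS4.1 x z μa b]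
    simp only [sub_self, abs_zero, mul_zero]
    exact hRHS0

end Lineage

end Summit.QuantumFields.BalabanUV.Beta.GAN24.BornBorderContactLineage
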